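import Summits.ABC.ABC.Theses.NegOmegaAtlas

/-!
# Birth skeleton (BC3) — crux `BalancedFamily` (stmt-ABC-1226), route `NegOmegaAtlas`

Route `route-ABC-NegOmegaAtlas` (ABC/ABC, negative side organised by the bounded-ω atlas); crux decl
`Summit.ABC.ABC.Theses.NegOmegaAtlas.BalancedFamily` (rank 3, cell (II-B) of the atlas is inhabited):

  `∃ k δ, 0 < δ ∧ ∀ η > 0, {abc triples (a,b,c) | ω(abc) ≤ k ∧ c^(1-η) < min(a,b) ∧ 1 + δ < q(a,b,c)}.Infinite`.

## The line: balanced prime Beal with mixed exponents (the `k = 3` sub-cell named in the crux docstring)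

At `k = 3` a balanced bounded-ω violating family consists of three prime powers `p^x + q^y = r^z`
(`p ≠ q` primes; then `r ∉ {p, q}`, `rad = pqr`, `ω = 3`).  For such a triple the quality is controlled by
the SIGNATURE alone: `log rad = (log a)/x + (log b)/y + (log c)/z < σ · log c`, `σ := 1/x + 1/y + 1/z`,
i.e. `q(a,b,c) > 1/σ` — no balance is needed for quality, and hyperbolicity with a margin
(`σ ≤ 1 - θ`) gives `q > 1/(1-θ) ≥ 1 + θ` uniformly.  So cell (II-B) at `k = 3` splits into two
independent open statements of opposite expected polarity plus one provable transfer lemma: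

* `stub_hyperbolicPrimeBealInfinite` (OPEN, the ¬abc-strength bet; expected FALSE): for some margin
  `θ > 0` there are infinitely many three-prime-power solutions `p^x + q^y = r^z` with
  `1/x + 1/y + 1/z ≤ 1 - θ` — the negation of Fermat–Catalan restricted to PRIME bases (per fixed
  signature finite by Darmon–Granville = `Literature.NumberTheory.DiophantineGeometry.darmon_granville`;
  known members: `2^5+7^2=3^4`, `7^3+13^2=2^9`, `2^7+17^3=71^2` and their swaps).  Balance is NOT asserted.
* `stub_unbalancedPrimeBealFinite` (OPEN, a Pillai-type WALL; expected TRUE, follows from abc): for every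
  `η > 0` only finitely many hyperbolic three-prime-power solutions are η-unbalanced
  (`min(p^x, q^y) ≤ (r^z)^(1-η)`), i.e. `|r^z - p^x| ≤ r^{z(1-η)}` has finitely many solutions in prime
  powers with hyperbolic signature — a uniform prime-power Pillai statement (open for VARYING bases;
  for fixed bases it is Baker/Stroeker–Tijdeman).  This is the `k = 3` prime-power shadow of
  `¬ UnbalancedFamily` (the route's rank-2 crux): the atlas content "an infinite hyperbolic prime-Beal
  family, if any, lives in the balanced cell".
* `stub_primePowerTripleQuality` (PROVABLE NOW, M-sized transfer lemma): a three-prime-power solution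
  with `p ≠ q` is an abc triple with `ω(abc) = 3` and `q(a,b,c) · (1/x + 1/y + 1/z) > 1`
  (`radical (p^x q^y r^z) = pqr`, `Real.log_pow`, `a, b < c`).

Assembly `BalancedFamily_of_stubs : <stub₁-sig> → <stub₂-sig> → <stub₃-sig> → <body of BalancedFamily>`
is a REAL proof (k := 3, δ := θ; `Set.Infinite.sdiff` of the infinite supply by the finite unbalanced
part, then the transfer lemma and `1 < q(1-θ) ⟹ 1 + θ < q`), and
`BalancedFamily_of : BalancedFamily := BalancedFamily_of_stubs stub₁ stub₂ stub₃` concludes the crux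
BY NAME.  `sorry` occurs ONLY in the three `stub_*` theorems.

Remark (parity; cf. `AbcValuationProduct.min_largestPrimeFactor_le_two` in the RibetTakahashiSplit
Theorems): in an abc triple exactly one member is even, so every member of the supply has `2 ∈ {p, q, r}` —
the family, if it exists, is `2^x + q^y = r^z` or `p^x + q^y = 2^z` with mixed, unbounded signatures
(all three known members contain `2`).  Nothing in the skeleton uses this; it sharpens where provers look.

BC3 (planner folder `bc/*_probe.lean`, 2026-08-17, farm rc 1 each = all probes FAIL as required): for each
stub `S`, `example : S → BalancedFamily`, `example : S → ABC`, `example : S → ¬ ABC` by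
`first | exact? | simpa | simpa [defs] | aesop | (unfold defs; aesop)` end in `unsolved goals` /
`aesop: failed to prove the goal after exhaustive search` (9/9), while the control `BalancedFamily →
BalancedFamily` closes by `exact?` in every file — no stub is cheaply the crux or the summit (no shredding).

Disproof used: none exists for this crux (`ledger crux ls stmt-ABC-1226`: no workfiles, 2026-08-17).
Negatives index (ABC, 2 entries: BelyiSqueeze DegBelyiLower, GlobalQuasiLogDerivative) — unrelated.
-/

-- `Summit.<Summit>.<Problem>`: for the single-conjunct summit `ABC` the duplicate `ABC.ABC` is mandated.
set_option linter.dupNamespace false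

namespace Summit.ABC.ABC.Cruxes.BalancedFamily.Birth

open Literature.NumberTheory.DiophantineGeometry
open Summit.ABC.ABC.Theses.NegOmegaAtlas

/-! ## The registered stubs -/

/-- **Stub 1 (OPEN; the ¬abc-strength half; expected FALSE).** Infinitely many hyperbolic prime-Beal
solutions with a uniform signature margin: for some `θ > 0` the set of value-triples
`(p^x, q^y, r^z)` with `p, q, r` prime, `p ≠ q`, `x, y, z ≥ 1`, `p^x + q^y = r^z` and
`1/x + 1/y + 1/z ≤ 1 - θ` is infinite.  (= ¬ Fermat–Catalan for prime bases with margin; each fixed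
signature is finite by Darmon–Granville; why it might fail: abc, and Baker's ω-refinement at ω = 3,
predict finiteness.)  Sources: DarmonGranville1995 Thm 2; Literature.Barriers.ABC.TijdemanZagierNeedsExponentThree
(knownFermatCatalan); arXiv:2206.14067 (Scott–Styer); BakerWustholz2007 §3.7. -/
theorem stub_hyperbolicPrimeBealInfinite :
    ∃ θ : ℝ, 0 < θ ∧ {t : ℕ × ℕ × ℕ | ∃ p q r x y z : ℕ, p.Prime ∧ q.Prime ∧ r.Prime ∧ p ≠ q ∧
      0 < x ∧ 0 < y ∧ 0 < z ∧ p ^ x + q ^ y = r ^ z ∧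
      (x : ℝ)⁻¹ + (y : ℝ)⁻¹ + (z : ℝ)⁻¹ ≤ 1 - θ ∧ t = (p ^ x, q ^ y, r ^ z)}.Infinite := by
  sorry

/-- **Stub 2 (OPEN; Pillai-type wall; expected TRUE).** For every `η > 0`, only finitely many hyperbolic
three-prime-power solutions `p^x + q^y = r^z` (`p ≠ q` primes, `x, y, z ≥ 1`, `1/x + 1/y + 1/z < 1`)
are η-unbalanced, `min(p^x, q^y) ≤ (r^z)^(1-η)`.  Follows from abc (the whole hyperbolic prime-power
solution set is then finite); unconditionally open for varying prime bases (uniform prime-power Pillai: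
`0 < r^z - p^x ≤ r^{z(1-η)}`); why it might fail: only via an infinite unbalanced hyperbolic prime-Beal
family, itself a disproof of abc located in cell (II-U).  Sources: deWeger2026 = arXiv:2602.08051 §1, §5
(gap / no-gap census); ScottStyer2004 = doi:10.1016/j.jnt.2003.11.008; EvertseGyory2015 §4.6;
in-tree walls `UnbalancedQuasiPolynomial`, `PrimeFloorBoundedOmega` of this route. -/
theorem stub_unbalancedPrimeBealFinite :
    ∀ η : ℝ, 0 < η → {t : ℕ × ℕ × ℕ | (∃ p q r x y z : ℕ, p.Prime ∧ q.Prime ∧ r.Prime ∧ p ≠ q ∧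
      0 < x ∧ 0 < y ∧ 0 < z ∧ p ^ x + q ^ y = r ^ z ∧
      (x : ℝ)⁻¹ + (y : ℝ)⁻¹ + (z : ℝ)⁻¹ < 1 ∧ t = (p ^ x, q ^ y, r ^ z)) ∧
      ((min t.1 t.2.1 : ℕ) : ℝ) ≤ (t.2.2 : ℝ) ^ (1 - η)}.Finite := by
  sorry

/-- **Stub 3 (PROVABLE NOW; transfer lemma, M-sized).** A three-prime-power solution `p^x + q^y = r^z`
with `p ≠ q` primes and `x, y, z ≥ 1` is an abc triple with exactly three prime factors and quality
`q(p^x, q^y, r^z) · (1/x + 1/y + 1/z) > 1`: indeed `r ∉ {p, q}`, `rad = pqr`, and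
`log p + log q + log r = (log a)/x + (log b)/y + (log c)/z < (1/x + 1/y + 1/z) · log c` since `a, b < c`.
(Fermat–Catalan quality computation; folklore.)  Sources: DarmonGranville1995 §5.2; Waldschmidt2014 Conj. 11. -/
theorem stub_primePowerTripleQuality :
    ∀ p q r x y z : ℕ, p.Prime → q.Prime → r.Prime → p ≠ q → 0 < x → 0 < y → 0 < z →
      p ^ x + q ^ y = r ^ z →
      Literature.NumberTheory.DiophantineGeometry.IsABCTriple (p ^ x) (q ^ y) (r ^ z) ∧
        (p ^ x * q ^ y * r ^ z).primeFactors.card = 3 ∧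
        1 < Literature.NumberTheory.DiophantineGeometry.quality (p ^ x) (q ^ y) (r ^ z) *
          ((x : ℝ)⁻¹ + (y : ℝ)⁻¹ + (z : ℝ)⁻¹) := by
  sorry

/-! ## Assembly (sorry-free) -/

/-- **ASSEMBLY (kernel-checked, no `sorry`).** The three stub statements imply the crux statement
(verbatim the body of `Summit.ABC.ABC.Theses.NegOmegaAtlas.BalancedFamily`) with `k := 3`, `δ := θ`:
for each `η > 0` the infinite supply minus its finite η-unbalanced part is an infinite set of balanced
abc triples with `ω = 3` and quality `> 1/(1-θ) ≥ 1 + θ`. [folklore] -/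
theorem BalancedFamily_of_stubs
    (hA : ∃ θ : ℝ, 0 < θ ∧ {t : ℕ × ℕ × ℕ | ∃ p q r x y z : ℕ, p.Prime ∧ q.Prime ∧ r.Prime ∧ p ≠ q ∧
      0 < x ∧ 0 < y ∧ 0 < z ∧ p ^ x + q ^ y = r ^ z ∧
      (x : ℝ)⁻¹ + (y : ℝ)⁻¹ + (z : ℝ)⁻¹ ≤ 1 - θ ∧ t = (p ^ x, q ^ y, r ^ z)}.Infinite)
    (hB : ∀ η : ℝ, 0 < η → {t : ℕ × ℕ × ℕ | (∃ p q r x y z : ℕ, p.Prime ∧ q.Prime ∧ r.Prime ∧ p ≠ q ∧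
      0 < x ∧ 0 < y ∧ 0 < z ∧ p ^ x + q ^ y = r ^ z ∧
      (x : ℝ)⁻¹ + (y : ℝ)⁻¹ + (z : ℝ)⁻¹ < 1 ∧ t = (p ^ x, q ^ y, r ^ z)) ∧
      ((min t.1 t.2.1 : ℕ) : ℝ) ≤ (t.2.2 : ℝ) ^ (1 - η)}.Finite)
    (hT : ∀ p q r x y z : ℕ, p.Prime → q.Prime → r.Prime → p ≠ q → 0 < x → 0 < y → 0 < z →
      p ^ x + q ^ y = r ^ z →
      Literature.NumberTheory.DiophantineGeometry.IsABCTriple (p ^ x) (q ^ y) (r ^ z) ∧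
        (p ^ x * q ^ y * r ^ z).primeFactors.card = 3 ∧
        1 < Literature.NumberTheory.DiophantineGeometry.quality (p ^ x) (q ^ y) (r ^ z) *
          ((x : ℝ)⁻¹ + (y : ℝ)⁻¹ + (z : ℝ)⁻¹)) :
    ∃ k : ℕ, ∃ δ : ℝ, 0 < δ ∧ ∀ η : ℝ, 0 < η → {t : ℕ × ℕ × ℕ |
      Literature.NumberTheory.DiophantineGeometry.IsABCTriple t.1 t.2.1 t.2.2 ∧
      (t.1 * t.2.1 * t.2.2).primeFactors.card ≤ k ∧ (t.2.2 : ℝ) ^ (1 - η) < ((min t.1 t.2.1 : ℕ) : ℝ) ∧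
      1 + δ < Literature.NumberTheory.DiophantineGeometry.quality t.1 t.2.1 t.2.2}.Infinite := by
  obtain ⟨θ, hθ, hinf⟩ := hA
  refine ⟨3, θ, hθ, fun η hη => ?_⟩
  refine (hinf.sdiff (hB η hη)).mono ?_
  rintro t ⟨ht, hnot⟩
  rw [Set.mem_setOf_eq] at ht hnot ⊢
  obtain ⟨p, q, r, x, y, z, hp, hq, hr, hpq, hx, hy, hz, heq, hσ, rfl⟩ := ht
  dsimp only at hnot ⊢
  obtain ⟨habc, hcard, hqual⟩ := hT p q r x y z hp hq hr hpq hx hy hz heq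
  -- balance: the triple is not in the finite η-unbalanced part
  have hbal : ((r ^ z : ℕ) : ℝ) ^ (1 - η) < ((min (p ^ x) (q ^ y) : ℕ) : ℝ) := by
    by_contra hle
    push Not at hle
    exact hnot ⟨⟨p, q, r, x, y, z, hp, hq, hr, hpq, hx, hy, hz, heq, lt_of_le_of_lt hσ (by linarith),
      rfl⟩, hle⟩
  refine ⟨habc, hcard.le, hbal, ?_⟩
  -- quality: `1 < q · σ`, `σ ≤ 1 - θ`, `0 ≤ q` ⟹ `1 + θ < q`
  have hQnn : 0 ≤ Literature.NumberTheory.DiophantineGeometry.quality (p ^ x) (q ^ y) (r ^ z) := by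
    unfold Literature.NumberTheory.DiophantineGeometry.quality
    exact div_nonneg (Real.log_natCast_nonneg _) (Real.log_natCast_nonneg _)
  have h1 : 1 < Literature.NumberTheory.DiophantineGeometry.quality (p ^ x) (q ^ y) (r ^ z) * (1 - θ) :=
    lt_of_lt_of_le hqual (mul_le_mul_of_nonneg_left hσ hQnn)
  rw [mul_sub, mul_one] at h1
  have hQθ : 0 ≤ Literature.NumberTheory.DiophantineGeometry.quality (p ^ x) (q ^ y) (r ^ z) * θ :=
    mul_nonneg hQnn hθ.le
  have hQ1 : 1 ≤ Literature.NumberTheory.DiophantineGeometry.quality (p ^ x) (q ^ y) (r ^ z) := by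
    linarith
  have hθQ : θ ≤ Literature.NumberTheory.DiophantineGeometry.quality (p ^ x) (q ^ y) (r ^ z) * θ :=
    le_mul_of_one_le_left hθ.le hQ1
  linarith

/-- **THE SKELETON THEOREM (registrar shape).** The crux
`Summit.ABC.ABC.Theses.NegOmegaAtlas.BalancedFamily`, concluded BY NAME from the three declared stubs
through the sorry-free assembly `BalancedFamily_of_stubs`; the only `sorry`s in its closure are
`stub_hyperbolicPrimeBealInfinite`, `stub_unbalancedPrimeBealFinite`, `stub_primePowerTripleQuality`. -/
theorem BalancedFamily_of : Summit.ABC.ABC.Theses.NegOmegaAtlas.BalancedFamily :=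
  BalancedFamily_of_stubs stub_hyperbolicPrimeBealInfinite stub_unbalancedPrimeBealFinite
    stub_primePowerTripleQuality

end Summit.ABC.ABC.Cruxes.BalancedFamily.Birth
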